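import Mathlib
import Summits.NavierStokesRegularity.NavierStokesRegularity.Theorems.EulerZoomLiouvillePowerGaugeEulerLiouvilleCondenserSharpCrossings
import Summits.NavierStokesRegularity.NavierStokesRegularity.Theorems.EulerZoomLiouvillePowerGaugeEulerLiouvilleCondenserCircleMeanCore
import Summits.NavierStokesRegularity.NavierStokesRegularity.Theorems.EulerZoomLiouvillePowerGaugeEulerLiouvilleCondenserWeightedQuietSlice

/-!
# THEOREM B′ — THE SHARP CONDENSER IN GAUGE FORM, from the plates t47-C and t47-Q (plate t47-B′, nsreg-p2 g35
ROUND-45 §1/§6, `r45/Sketch45.lean` `NsregP2.R45.SharpCondenserGaugeForm`)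

Width piece for crux `EulerZoomLiouville.PowerGaugeEulerLiouville` (stmt-NavierStokesRegularity-19832), by name under
LEAD 19832 (ns-typeII-p2 g13); seat ns-sfl-p1 g6, `--supports stmt-NavierStokesRegularity-19832 --as helper`.

* `sharpCondenserGaugeForm_of hC hQ` — **THEOREM B′ with the ROUND-45 constant**: the conclusion is the Sketch45 text
  `NsregP2.R45.SharpCondenserGaugeForm` VERBATIM (exit ratio `Λ > 1`, budgets and located point on `B(0,(Λ+1)R)`, every
  `κ' < κ_B(Λ) = 2πγ²(Λ³−1)/(3(Λ+1)^{1−ρ}C_E)` in the exponent), the hypotheses `hC`, `hQ` are the texts of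
  `NsregP2.R45.CircleMeanCondenserCore` (t47-C) and `NsregP2.R45.WeightedQuietSlice` (t47-Q) VERBATIM (typed by
  ns-ezl-w2 g4: `Condenser.circleMeanCondenserCore` p669142, `Condenser.weightedQuietSlice` p669481);
* **`sharpCondenserGaugeForm` — THEOREM B′ UNCONDITIONALLY**, the Sketch45 text VERBATIM, `:= sharpCondenserGaugeForm_of
  circleMeanCondenserCore weightedQuietSlice`;
* the margin arithmetic: `exists_loss_parameter` (a loss `t = δ = η ∈ (0,1/4]` with raised coefficient
  `κ₁(t) = 2π(1−2t)²γ²(μ³−1)/(3C_E(Λ+1)^{1−ρ}) > κ'`, `μ = 1+(1−t)(Λ−1)`, by continuity at `t = 0` where `κ₁(0) = κ_B(Λ)`),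
  `sharpExponent_identity` (`κ₁R^{2+ρ}·E_s = 2π(1−2t)²γ²s²` for the weighted slice energy `E_s = 3Y s²/((μ³−1)R³)`,
  `Y = C_E((Λ+1)R)^{1−ρ}`), `sharp_amplitude_le` (the outer-mean term `√(2A/π)/(R/2) ≤ tγR` once
  `R ≥ 8C_A(Λ+1)/(πt(Λ−1)t²γ²)`), `sharp_drop_absurd`, `sharp_exp_absurd` (the two alternatives of the core contradict
  the envelope `‖DV‖ < exp(κ'R^{2+ρ})` on `B(0,(Λ+1)R)` once `R ≥ |log(2tγ)|/(κ₁−κ') + 1`).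

CHECK VALUE (ROUND-45 Day 2): at `Λ = 2` the constant is `2πγ²·7/(3·3^{1−ρ}C_E) = 14πγ²/(3·3^{1−ρ}C_E)`, against
t44-B's `πγ²/(128·3^{1−ρ}C_E)` (`Condenser.exists_gradient_ge_exp_rpow_of_exit`): ratio `1792/3`.
HONEST FRAMING: real analysis in `ℝ³` (with a cut-off flow); nothing here proves the crux E (19832 OPEN), any door
Target, or any Navier–Stokes statement; no summit statement is touched. [nsreg-p2 ROUND-45 THEOREM B′; folklore
(length–area method); cite: ConstantinIgnatovaVicol2026Putative, §3.4.1 for the setting]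
-/

noncomputable section

open Set Filter Topology Metric Function MeasureTheory Real
open scoped RealInnerProductSpace

set_option linter.dupNamespace false

namespace Summit.NavierStokesRegularity.NavierStokesRegularity.Theorems.PowerGaugeEulerLiouville.Condenser

open Literature.Analysis Literature.Analysis.FluidPDE

/-! ## The margin arithmetic of THEOREM B′ -/

/-- **The sharp exponent identity**: with `Y = C_E((Λ+1)R)^{1−ρ}`, slice energy `E_s = 3Y s²/((μ³−1)R³)` and
`κ₁ = 2π(1−2t)²γ²(μ³−1)/(3C_E(Λ+1)^{1−ρ})`:  `κ₁ R^{2+ρ} · E_s = 2π(1−2t)²γ² s²`. [folklore] -/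
theorem sharpExponent_identity {γ ρ C_E Λ μ t R s : ℝ} (hCE : 0 < C_E) (hΛ : 0 < Λ + 1) (hμ : 0 < μ ^ 3 - 1)
    (hR : 0 < R) :
    2 * Real.pi * (1 - 2 * t) ^ 2 * γ ^ 2 * (μ ^ 3 - 1) / (3 * C_E * (Λ + 1) ^ (1 - ρ)) * R ^ (2 + ρ) *
        (3 * (C_E * ((Λ + 1) * R) ^ (1 - ρ)) / ((μ ^ 3 - 1) * R ^ 3) * s ^ 2) =
      2 * Real.pi * (1 - 2 * t) ^ 2 * γ ^ 2 * s ^ 2 := by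
  have h1 : ((Λ + 1) * R) ^ (1 - ρ) = (Λ + 1) ^ (1 - ρ) * R ^ (1 - ρ) := Real.mul_rpow hΛ.le hR.le
  have h2 : R ^ (2 + ρ) * R ^ (1 - ρ) = R ^ 3 := by
    rw [← Real.rpow_add hR, show (2 + ρ) + (1 - ρ) = ((3 : ℕ) : ℝ) by push_cast; ring, Real.rpow_natCast]
  have hL : 0 < (Λ + 1) ^ (1 - ρ) := Real.rpow_pos_of_pos hΛ _
  have hR3 : 0 < R ^ 3 := by positivity
  rw [h1]
  field_simp
  rw [← h2]
  ring

/-- Choice of the loss parameter: the coefficient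
`f(t) = 2π(1−2t)²γ²((1+(1−t)(Λ−1))³−1)/(3C_E(Λ+1)^{1−ρ})` is continuous with `f(0) = κ_B(Λ)`, so some `t ∈ (0, 1/4]`
still has `f(t) > κ'` whenever `κ' < κ_B(Λ)`. [folklore] -/
theorem exists_loss_parameter {γ ρ C_E Λ κ' : ℝ}
    (hκ : κ' < 2 * Real.pi * γ ^ 2 * (Λ ^ 3 - 1) / (3 * (Λ + 1) ^ (1 - ρ) * C_E)) :
    ∃ t : ℝ, 0 < t ∧ t ≤ 1 / 4 ∧
      κ' < 2 * Real.pi * (1 - 2 * t) ^ 2 * γ ^ 2 * ((1 + (1 - t) * (Λ - 1)) ^ 3 - 1) / (3 * C_E * (Λ + 1) ^ (1 - ρ)) := by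
  set f : ℝ → ℝ := fun t =>
    2 * Real.pi * (1 - 2 * t) ^ 2 * γ ^ 2 * ((1 + (1 - t) * (Λ - 1)) ^ 3 - 1) / (3 * C_E * (Λ + 1) ^ (1 - ρ)) with hf
  have hfc : Continuous f := by
    simp only [hf]
    fun_prop
  have hf0 : f 0 = 2 * Real.pi * γ ^ 2 * (Λ ^ 3 - 1) / (3 * (Λ + 1) ^ (1 - ρ) * C_E) := by
    simp only [hf]; ring
  have hev : ∀ᶠ t in 𝓝 (0 : ℝ), κ' < f t := hfc.continuousAt.eventually (lt_mem_nhds (by rw [hf0]; exact hκ))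
  obtain ⟨ε, hε, hball⟩ := Metric.eventually_nhds_iff.1 hev
  refine ⟨min (ε / 2) (1 / 4), by positivity, min_le_right _ _, ?_⟩
  have h := hball (y := min (ε / 2) (1 / 4)) (by
    rw [Real.dist_eq, sub_zero, abs_of_pos (by positivity)]
    exact (min_le_left _ _).trans_lt (by linarith))
  simpa only [hf] using h

/-- Amplitude bookkeeping for THEOREM B′: with `X = C_A((Λ+1)R)^{1−2ρ}`, `A = X/(t(Λ−1)R)`, `r = R/2` and
`R ≥ max(1, 8C_A(Λ+1)/(πt(Λ−1)t²γ²))`, the outer-mean term `√(2A/π)/r` is at most `tγR`. [folklore] -/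
theorem sharp_amplitude_le {C_A Λ t γ ρ R : ℝ} (hCA : 0 < C_A) (hΛ : 1 < Λ) (ht : 0 < t) (hγ : 0 < γ) (hρ : 0 ≤ ρ)
    (h1 : 1 ≤ R) (hRa : 8 * C_A * (Λ + 1) / (Real.pi * t * (Λ - 1)) / (t ^ 2 * γ ^ 2) ≤ R) :
    Real.sqrt (2 * (C_A * ((Λ + 1) * R) ^ (1 - 2 * ρ) / (t * (Λ - 1) * R)) / Real.pi) / (R / 2) ≤ t * γ * R := by
  have hπ : 0 < Real.pi := Real.pi_pos
  have hR : 0 < R := by linarith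
  have hΛm : 0 < Λ - 1 := by linarith
  have hΛ1 : 0 < Λ + 1 := by linarith
  -- `X ≤ C_A (Λ+1) R`
  have hXle : C_A * ((Λ + 1) * R) ^ (1 - 2 * ρ) ≤ C_A * ((Λ + 1) * R) := by
    refine mul_le_mul_of_nonneg_left ?_ hCA.le
    have hbase : 1 ≤ (Λ + 1) * R := by nlinarith
    calc ((Λ + 1) * R) ^ (1 - 2 * ρ) ≤ ((Λ + 1) * R) ^ (1 : ℝ) :=
          Real.rpow_le_rpow_of_exponent_le hbase (by linarith)
      _ = (Λ + 1) * R := Real.rpow_one _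
  have hX0 : 0 ≤ C_A * ((Λ + 1) * R) ^ (1 - 2 * ρ) := by positivity
  -- the square of the amplitude term
  have hsq : (Real.sqrt (2 * (C_A * ((Λ + 1) * R) ^ (1 - 2 * ρ) / (t * (Λ - 1) * R)) / Real.pi) / (R / 2)) ^ 2 =
      8 * (C_A * ((Λ + 1) * R) ^ (1 - 2 * ρ)) / (Real.pi * t * (Λ - 1) * R ^ 3) := by
    rw [div_pow, Real.sq_sqrt (by positivity)]
    field_simp
    ring
  have hsq_le : (Real.sqrt (2 * (C_A * ((Λ + 1) * R) ^ (1 - 2 * ρ) / (t * (Λ - 1) * R)) / Real.pi) / (R / 2)) ^ 2 ≤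
      8 * C_A * (Λ + 1) / (Real.pi * t * (Λ - 1)) / R ^ 2 := by
    rw [hsq, div_div, div_le_div_iff₀ (by positivity) (by positivity)]
    have hR2 : 0 < R ^ 2 := by positivity
    calc 8 * (C_A * ((Λ + 1) * R) ^ (1 - 2 * ρ)) * (Real.pi * t * (Λ - 1) * R ^ 2)
        ≤ 8 * (C_A * ((Λ + 1) * R)) * (Real.pi * t * (Λ - 1) * R ^ 2) := by gcongr
      _ = 8 * C_A * (Λ + 1) * (Real.pi * t * (Λ - 1) * R ^ 3) := by ring
  -- `D/R² ≤ (tγR)²`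
  have hD : 8 * C_A * (Λ + 1) / (Real.pi * t * (Λ - 1)) ≤ t ^ 2 * γ ^ 2 * R := by
    have := (div_le_iff₀ (by positivity : (0 : ℝ) < t ^ 2 * γ ^ 2)).1 hRa
    linarith
  have hfin : 8 * C_A * (Λ + 1) / (Real.pi * t * (Λ - 1)) / R ^ 2 ≤ (t * γ * R) ^ 2 := by
    rw [div_le_iff₀ (by positivity)]
    have hR3 : R ≤ R ^ 4 := by
      calc R = R ^ 1 := (pow_one R).symm
        _ ≤ R ^ 4 := pow_le_pow_right₀ h1 (by norm_num)
    have ht2 : 0 ≤ t ^ 2 * γ ^ 2 := by positivity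
    calc 8 * C_A * (Λ + 1) / (Real.pi * t * (Λ - 1)) ≤ t ^ 2 * γ ^ 2 * R := hD
      _ ≤ t ^ 2 * γ ^ 2 * R ^ 4 := mul_le_mul_of_nonneg_left hR3 ht2
      _ = (t * γ * R) ^ 2 * R ^ 2 := by ring
  exact (pow_le_pow_iff_left₀ (by positivity) (by positivity) two_ne_zero).1 (hsq_le.trans hfin)

/-- The small-drop alternative of the core is impossible once the outer-mean term is `≤ tγs` and `t ≤ 1/4`. [folklore] -/
theorem sharp_drop_absurd {t γ s a : ℝ} (ht4 : t ≤ 1 / 4) (hm : 0 < γ * s) (haS : a ≤ t * (γ * s))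
    (h : (1 - t) * (γ * s) ≤ a) : False := by
  nlinarith

/-- The exponential alternative of the core contradicts the gradient envelope `exp(κ' R^{2+ρ})` once
`κ₁ > κ'`, `R ≥ |log(2tγ)|/(κ₁ − κ') + 1` and `R ≤ P = R^{2+ρ}` (`κ₁ P E_s = 2π(1−2t)²γ²s²`). [folklore] -/
theorem sharp_exp_absurd {κ₁ κ' t γ s R a Es P : ℝ} (hgap : κ' < κ₁) (ht : 0 < t) (ht4 : t ≤ 1 / 4) (hγ : 0 < γ)
    (hR : 0 < R) (hsR : R ≤ s) (haS : a ≤ t * (γ * s)) (hEs : 0 < Es) (hP : R ≤ P)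
    (hid : κ₁ * P * Es = 2 * Real.pi * (1 - 2 * t) ^ 2 * γ ^ 2 * s ^ 2)
    (hRb : |Real.log (2 * t * γ)| / (κ₁ - κ') + 1 ≤ R)
    (h : t * (γ * s) / (R / 2) * Real.exp (2 * Real.pi * ((1 - t) * (γ * s) - a) ^ 2 / Es) ≤ Real.exp (κ' * P)) :
    False := by
  have hπ : 0 < Real.pi := Real.pi_pos
  have hgap' : 0 < κ₁ - κ' := sub_pos.2 hgap
  have hspos : 0 < s := hR.trans_le hsR
  -- the exponent is at least `κ₁ P`
  have hQ' : κ₁ * P ≤ 2 * Real.pi * ((1 - t) * (γ * s) - a) ^ 2 / Es := by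
    rw [le_div_iff₀ hEs, hid]
    have hlow : (1 - 2 * t) * (γ * s) ≤ (1 - t) * (γ * s) - a := by nlinarith
    have hlow0 : 0 ≤ (1 - 2 * t) * (γ * s) := mul_nonneg (by linarith) (mul_pos hγ hspos).le
    have hsq : ((1 - 2 * t) * (γ * s)) ^ 2 ≤ ((1 - t) * (γ * s) - a) ^ 2 := pow_le_pow_left₀ hlow0 hlow 2
    nlinarith [hsq, hπ]
  -- the prefactor is at least `2tγ`
  have hpre : 2 * t * γ ≤ t * (γ * s) / (R / 2) := by
    rw [le_div_iff₀ (by positivity)]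
    have : t * γ * R ≤ t * γ * s := mul_le_mul_of_nonneg_left hsR (mul_pos ht hγ).le
    linarith
  have hexp1 : 2 * t * γ * Real.exp (κ₁ * P) ≤ Real.exp (κ' * P) := by
    calc 2 * t * γ * Real.exp (κ₁ * P)
        ≤ t * (γ * s) / (R / 2) * Real.exp (2 * Real.pi * ((1 - t) * (γ * s) - a) ^ 2 / Es) := by
          gcongr
      _ ≤ Real.exp (κ' * P) := h
  -- hence `(κ₁ − κ') P ≤ −log(2tγ) ≤ |log(2tγ)|`
  have htγ : 0 < 2 * t * γ := by positivity
  have hexp2 : Real.exp ((κ₁ - κ') * P) ≤ (2 * t * γ)⁻¹ := by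
    rw [sub_mul, Real.exp_sub, div_le_iff₀ (Real.exp_pos _), ← div_eq_inv_mul, le_div_iff₀ htγ]
    linarith
  have hlog : (κ₁ - κ') * P ≤ |Real.log (2 * t * γ)| := by
    have h2 : Real.exp ((κ₁ - κ') * P) ≤ Real.exp (Real.log (2 * t * γ)⁻¹) := by
      rw [Real.exp_log (inv_pos.2 htγ)]; exact hexp2
    have h3 := Real.exp_le_exp.1 h2
    rw [Real.log_inv] at h3
    exact h3.trans (neg_le_abs _)
  -- but `P ≥ R > |log(2tγ)|/(κ₁ − κ')`
  have hbig : |Real.log (2 * t * γ)| < (κ₁ - κ') * R := by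
    have := (div_le_iff₀ hgap').1 (by linarith : |Real.log (2 * t * γ)| / (κ₁ - κ') ≤ R - 1)
    nlinarith
  have hmono : (κ₁ - κ') * R ≤ (κ₁ - κ') * P := mul_le_mul_of_nonneg_left hP hgap'.le
  linarith

/-- **THEOREM B′ from the two plates.**  `hC`, `hQ` = the texts of `NsregP2.R45.CircleMeanCondenserCore` (t47-C) and
`NsregP2.R45.WeightedQuietSlice` (t47-Q) verbatim; the conclusion is `NsregP2.R45.SharpCondenserGaugeForm` verbatim:
exit ratio `Λ > 1`, budgets and the located point on `B(0,(Λ+1)R)`, and EVERY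
`κ' < κ_B(Λ) = 2πγ²(Λ³−1)/(3(Λ+1)^{1−ρ}C_E)` in the exponent (the prefactor `2tγ` and the `(1−2t)², (1−t)` losses are
absorbed by the margin `κ_B(Λ) − κ'` for `R ≥ R₁(γ,ρ,C_A,C_E,Λ,κ')`). [nsreg-p2 ROUND-45 THEOREM B′; folklore
(length–area method); cite: ConstantinIgnatovaVicol2026Putative, §3.4.1 for the setting] -/
theorem sharpCondenserGaugeForm_of
    (hC : ∀ (ψ : ℂ → ℝ) (m G A E r δ : ℝ), ContDiff ℝ 1 ψ → 0 < m → m ≤ ψ 0 → 0 < r → 0 < δ → δ < 1 → 0 < E →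
      (∀ z ∈ closedBall (0 : ℂ) r, ‖fderiv ℝ ψ z‖ ≤ G) →
      (∫ z in closedBall (0 : ℂ) r, ψ z ^ 2 ≤ A) →
      (∫ z in closedBall (0 : ℂ) r, ‖fderiv ℝ ψ z‖ ^ 2 ≤ E) →
      (1 - δ) * m ≤ Real.sqrt (2 * A / Real.pi) / r ∨
        δ * m / r * Real.exp (2 * Real.pi * ((1 - δ) * m - Real.sqrt (2 * A / Real.pi) / r) ^ 2 / E) ≤ G)
    (hQ : ∀ (F G : EuclideanSpace ℝ (Fin 3) → ℝ), Continuous F → Continuous G → (∀ x, 0 ≤ F x) → (∀ x, 0 ≤ G x) →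
      ∀ (R Λ R' η X Y : ℝ), 0 < R → 1 < Λ → 0 < η → η < 1 → 0 < X → 0 < Y →
        (∫ x in ball (0 : EuclideanSpace ℝ (Fin 3)) R', F x ≤ X) →
        (∫ x in ball (0 : EuclideanSpace ℝ (Fin 3)) R', G x ≤ Y) →
        ∃ s ∈ Icc R (Λ * R),
          ∫ a, (ball (0 : EuclideanSpace ℝ (Fin 3)) R').indicator F (plane s a) ≤ X / (η * (Λ - 1) * R) ∧
          ∫ a, (ball (0 : EuclideanSpace ℝ (Fin 3)) R').indicator G (plane s a) ≤
            3 * Y / (((1 + (1 - η) * (Λ - 1)) ^ 3 - 1) * R ^ 3) * s ^ 2) :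
    ∀ (γ ρ C_A C_E Λ κ' : ℝ), 0 < γ → 0 ≤ ρ → 0 < C_A → 0 < C_E → 1 < Λ →
      κ' < 2 * Real.pi * γ ^ 2 * (Λ ^ 3 - 1) / (3 * (Λ + 1) ^ (1 - ρ) * C_E) →
      ∃ R₁ : ℝ, 0 < R₁ ∧
        ∀ (V : EuclideanSpace ℝ (Fin 3) → EuclideanSpace ℝ (Fin 3)) (K : ℝ), ContDiff ℝ 1 V →
          (∀ y, ‖fderiv ℝ V y‖ ≤ K) →
          ∀ R : ℝ, R₁ ≤ R →
            (∫ x in ball (0 : EuclideanSpace ℝ (Fin 3)) ((Λ + 1) * R), ‖V x‖ ^ 2 ≤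
                C_A * ((Λ + 1) * R) ^ (1 - 2 * ρ)) →
            (∫ x in ball (0 : EuclideanSpace ℝ (Fin 3)) ((Λ + 1) * R), ‖fderiv ℝ V x‖ ^ 2 ≤
                C_E * ((Λ + 1) * R) ^ (1 - ρ)) →
            ∀ (y : EuclideanSpace ℝ (Fin 3)) (L : ℝ), 0 ≤ L → ‖y‖ < R →
              Λ * R ≤ ‖ODE.evolutionMap (fun _ : ℝ => selfSimilarTransport γ 0 V) 0 (-L) y‖ →
              ∃ z ∈ ball (0 : EuclideanSpace ℝ (Fin 3)) ((Λ + 1) * R),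
                Real.exp (κ' * R ^ (2 + ρ)) ≤ ‖fderiv ℝ V z‖ := by
  intro γ ρ C_A C_E Λ κ' hγ hρ hCA hCE hΛ hκ
  have hΛ1 : 0 < Λ + 1 := by linarith
  have hΛm : 0 < Λ - 1 := by linarith
  -- the loss parameter `t` (= δ = η) and the raised coefficient `κ₁ > κ'`
  obtain ⟨t, ht0, ht4, hκ₁⟩ := exists_loss_parameter (γ := γ) (ρ := ρ) (C_E := C_E) (Λ := Λ) hκ
  have ht1 : t < 1 := by linarith
  have hμ : 1 < 1 + (1 - t) * (Λ - 1) := by nlinarith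
  have hμ3 : 0 < (1 + (1 - t) * (Λ - 1)) ^ 3 - 1 := by
    nlinarith [pow_lt_pow_left₀ hμ zero_le_one three_ne_zero]
  obtain ⟨κ₁, hκ₁def⟩ : ∃ κ₁ : ℝ, κ₁ = 2 * Real.pi * (1 - 2 * t) ^ 2 * γ ^ 2 * ((1 + (1 - t) * (Λ - 1)) ^ 3 - 1) /
      (3 * C_E * (Λ + 1) ^ (1 - ρ)) := ⟨_, rfl⟩
  rw [← hκ₁def] at hκ₁
  have hgap : 0 < κ₁ - κ' := sub_pos.2 hκ₁
  -- the threshold radius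
  refine ⟨max 1 (max (8 * C_A * (Λ + 1) / (Real.pi * t * (Λ - 1)) / (t ^ 2 * γ ^ 2))
      (|Real.log (2 * t * γ)| / (κ₁ - κ') + 1)), lt_max_of_lt_left one_pos, ?_⟩
  intro V K hV hK R hR hA hE y L hL hy hexit
  have h1 : 1 ≤ R := (le_max_left _ _).trans hR
  have hRa : 8 * C_A * (Λ + 1) / (Real.pi * t * (Λ - 1)) / (t ^ 2 * γ ^ 2) ≤ R :=
    ((le_max_left _ _).trans (le_max_right _ _)).trans hR
  have hRb : |Real.log (2 * t * γ)| / (κ₁ - κ') + 1 ≤ R := ((le_max_right _ _).trans (le_max_right _ _)).trans hR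
  have hR0 : 0 < R := by linarith
  have hX : 0 < C_A * ((Λ + 1) * R) ^ (1 - 2 * ρ) := mul_pos hCA (Real.rpow_pos_of_pos (by positivity) _)
  have hY : 0 < C_E * ((Λ + 1) * R) ^ (1 - ρ) := mul_pos hCE (Real.rpow_pos_of_pos (by positivity) _)
  by_contra hcon
  push Not at hcon
  have hGm : ∀ z ∈ ball (0 : EuclideanSpace ℝ (Fin 3)) ((Λ + 1) * R),
      ‖fderiv ℝ V z‖ ≤ Real.exp (κ' * R ^ (2 + ρ)) := fun z hz => (hcon z hz).le
  obtain ⟨s, hs, halt⟩ := exists_slice_alternative_of_exit hC hQ hV hK hγ hR0 hΛ ht0 ht1 ht0 ht1 hX hY hA hE hGm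
    hy hL hexit
  have hsR : R ≤ s := hs.1
  have hm : 0 < γ * s := mul_pos hγ (hR0.trans_le hsR)
  -- the outer-mean term is `≤ tγR ≤ tγs`
  have haR := sharp_amplitude_le (ρ := ρ) hCA hΛ ht0 hγ hρ h1 hRa
  have haS : Real.sqrt (2 * (C_A * ((Λ + 1) * R) ^ (1 - 2 * ρ) / (t * (Λ - 1) * R)) / Real.pi) / (R / 2) ≤
      t * (γ * s) := by
    have : t * γ * R ≤ t * γ * s := mul_le_mul_of_nonneg_left hsR (mul_pos ht0 hγ).le
    linarith
  rcases halt with h | h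
  · exact sharp_drop_absurd ht4 hm haS h
  · have hspos : 0 < s := hR0.trans_le hsR
    have hEs : 0 < 3 * (C_E * ((Λ + 1) * R) ^ (1 - ρ)) / (((1 + (1 - t) * (Λ - 1)) ^ 3 - 1) * R ^ 3) * s ^ 2 :=
      mul_pos (div_pos (by positivity) (mul_pos hμ3 (by positivity))) (by positivity)
    have hP : R ≤ R ^ (2 + ρ) := by
      calc R = R ^ (1 : ℝ) := (Real.rpow_one R).symm
        _ ≤ R ^ (2 + ρ) := Real.rpow_le_rpow_of_exponent_le h1 (by linarith)
    have hid : κ₁ * R ^ (2 + ρ) *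
        (3 * (C_E * ((Λ + 1) * R) ^ (1 - ρ)) / (((1 + (1 - t) * (Λ - 1)) ^ 3 - 1) * R ^ 3) * s ^ 2) =
        2 * Real.pi * (1 - 2 * t) ^ 2 * γ ^ 2 * s ^ 2 := by
      rw [hκ₁def]
      exact sharpExponent_identity hCE hΛ1 hμ3 hR0
    exact sharp_exp_absurd hκ₁ ht0 ht4 hγ hR0 hsR haS hEs hP hid hRb h

/-- **THEOREM B′ — THE SHARP CONDENSER IN GAUGE FORM** (nsreg-p2 ROUND-45 §1; the statement is
`NsregP2.R45.SharpCondenserGaugeForm` of `r45/Sketch45.lean` VERBATIM), UNCONDITIONAL: the plates t47-C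
(`Condenser.circleMeanCondenserCore`, ns-ezl-w2 g4) and t47-Q (`Condenser.weightedQuietSlice`, ns-ezl-w2 g4) discharge the
two hypotheses of `sharpCondenserGaugeForm_of`.  `0 < γ`, `0 ≤ ρ`, `C_A, C_E > 0`, exit ratio `Λ > 1`, and ANY
`κ' < κ_B(Λ) = 2πγ²(Λ³−1)/(3(Λ+1)^{1−ρ}C_E)`: there is `R₁ > 0` such that for every `C¹` field `V` with bounded derivative,
every `R ≥ R₁` with the ball budgets `∫_{B(0,(Λ+1)R)}‖V‖² ≤ C_A((Λ+1)R)^{1−2ρ}`, `∫_{B(0,(Λ+1)R)}‖DV‖² ≤ C_E((Λ+1)R)^{1−ρ}`,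
and every label `‖y‖ < R` whose backward similarity orbit reaches `‖Ψ_L y‖ ≥ ΛR`, some `z ∈ B(0,(Λ+1)R)` has
`‖DV(z)‖ ≥ exp(κ' R^{2+ρ})`.  At `Λ = 2`: `κ_B = 14πγ²/(3·3^{1−ρ}C_E)`, `1792/3` times t44-B's constant.
[nsreg-p2 ROUND-45 THEOREM B′; folklore (length–area method); cite: ConstantinIgnatovaVicol2026Putative, §3.4.1] -/
theorem sharpCondenserGaugeForm :
    ∀ (γ ρ C_A C_E Λ κ' : ℝ), 0 < γ → 0 ≤ ρ → 0 < C_A → 0 < C_E → 1 < Λ →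
      κ' < 2 * Real.pi * γ ^ 2 * (Λ ^ 3 - 1) / (3 * (Λ + 1) ^ (1 - ρ) * C_E) →
      ∃ R₁ : ℝ, 0 < R₁ ∧
        ∀ (V : EuclideanSpace ℝ (Fin 3) → EuclideanSpace ℝ (Fin 3)) (K : ℝ), ContDiff ℝ 1 V →
          (∀ y, ‖fderiv ℝ V y‖ ≤ K) →
          ∀ R : ℝ, R₁ ≤ R →
            (∫ x in ball (0 : EuclideanSpace ℝ (Fin 3)) ((Λ + 1) * R), ‖V x‖ ^ 2 ≤
                C_A * ((Λ + 1) * R) ^ (1 - 2 * ρ)) →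
            (∫ x in ball (0 : EuclideanSpace ℝ (Fin 3)) ((Λ + 1) * R), ‖fderiv ℝ V x‖ ^ 2 ≤
                C_E * ((Λ + 1) * R) ^ (1 - ρ)) →
            ∀ (y : EuclideanSpace ℝ (Fin 3)) (L : ℝ), 0 ≤ L → ‖y‖ < R →
              Λ * R ≤ ‖ODE.evolutionMap (fun _ : ℝ => selfSimilarTransport γ 0 V) 0 (-L) y‖ →
              ∃ z ∈ ball (0 : EuclideanSpace ℝ (Fin 3)) ((Λ + 1) * R),
                Real.exp (κ' * R ^ (2 + ρ)) ≤ ‖fderiv ℝ V z‖ :=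
  sharpCondenserGaugeForm_of circleMeanCondenserCore weightedQuietSlice

end Summit.NavierStokesRegularity.NavierStokesRegularity.Theorems.PowerGaugeEulerLiouville.Condenser

end
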